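import Summits.CriticalPhenomena.CardyFormulaZ2.Theorems.StripClusterRates.Negative.SubmultiplicativeOne

/-!
# Passage to the limit in finite-length quasi-multiplicative bounds (limsup half of the Cardy-order transfer)

Support file for line `two-cluster-rate-is-stationary-gap` (crux `StripClusterRates`,
stmt-CriticalPhenomena-13878), lead c5, stub `qm_limit_le_of_finite_bounds`.

The crux takes its limits in TRANSFER-MATRIX ORDER (`m → ∞` at fixed width `n`, then `n → ∞`):
`γ₂(n) = lim_m −log p₂(m,n)/m`, `n·γ₂(n) → 2π`; Cardy's prediction is printed in CARDY ORDER
(fixed aspect ratio `A`, `n → ∞`, then `A → ∞`). The companion file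
`CardyBoundaryCoulombGasStripClusterRatesTwoClusterCardyOrderLiminf` lands the liminf half
`c ≤ L₂` of the transfer "Cardy order ⇒ TM order" from sub-multiplicativity. This file is the
purely real-analytic LIMSUP half, with everything abstracted: `P : ℕ → ℕ → ℝ` and `γ₂ : ℕ → ℝ`
are arbitrary, and the input is a family of FINITE-LENGTH UPPER bounds
`γ₂(n) ≤ (−log P(m,n) + log C)/(m + k·n)` (`m, n ≥ 1`; these are what quasi-SUPER-multiplicativity
of `p₂` in the length with an `n`-uniform constant `C` and gluing loss `k·n` would give, and are
produced by the neighbouring stub `qm_rate_le_finite`).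

* `qm2_limit_le_aspect`: at a fixed integer aspect ratio `A ≥ 1`, if `−log P(A·n, n) → G` then every
  limit `L₂` of `n·γ₂(n)` has `L₂ ≤ (G + log C)/(A + k)` — because at `m = A·n` the bound multiplied
  by `n` is EXACTLY `(−log P(A·n,n) + log C)/(A + k)`.
* `qm2_tendsto_bound`: `(g A + log C)/(A + k) → c` when `g(A)/A → c`.
* `qm_limit_le_of_finite_bounds` (registered form): hence `L₂ ≤ c`.

No definitions, Mathlib only.

References: [Cardy1998] eq. (bb) (the prediction being transferred); M. Fekete (1923).
-/

noncomputable section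

open MeasureTheory Filter Topology
open Literature.Probability.LatticeModels Literature.Probability.Percolation

namespace Summit.CriticalPhenomena.CardyFormulaZ2.Cruxes.StripClusterRates.TwoClusterRateIsStationaryGap

/-! ## Elementary limits in the aspect ratio -/

/-- `A/(A+k) → 1` along the naturals. [folklore] -/
theorem qm2_tendsto_aspect_ratio (k : ℕ) :
    Tendsto (fun A : ℕ ↦ (A : ℝ) / ((A : ℝ) + k)) atTop (𝓝 1) := by
  have h : Tendsto (fun A : ℕ ↦ 1 / (1 + (k : ℝ) / (A : ℝ))) atTop (𝓝 (1 / (1 + 0))) := by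
    refine tendsto_const_nhds.div (tendsto_const_nhds.add ?_) (by norm_num)
    exact tendsto_const_nhds.div_atTop tendsto_natCast_atTop_atTop
  rw [add_zero, div_one] at h
  refine h.congr' ?_
  filter_upwards [eventually_ge_atTop 1] with A hA
  have hA' : (0 : ℝ) < A := by exact_mod_cast hA
  have hAk : (0 : ℝ) < (A : ℝ) + k := by positivity
  field_simp

/-- `(g A + x)/(A + k) → c` whenever `g(A)/A → c` (`x/(A+k) → 0`, `A/(A+k) → 1`). [folklore] -/
theorem qm2_tendsto_bound {g : ℕ → ℝ} {c : ℝ} (hc : Tendsto (fun A : ℕ ↦ g A / A) atTop (𝓝 c))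
    (x : ℝ) (k : ℕ) : Tendsto (fun A : ℕ ↦ (g A + x) / ((A : ℝ) + k)) atTop (𝓝 c) := by
  have h : Tendsto (fun A : ℕ ↦ (g A / A + x / A) * ((A : ℝ) / ((A : ℝ) + k))) atTop
      (𝓝 ((c + 0) * 1)) :=
    (hc.add (tendsto_const_nhds.div_atTop tendsto_natCast_atTop_atTop)).mul
      (qm2_tendsto_aspect_ratio k)
  rw [add_zero, mul_one] at h
  refine h.congr' ?_
  filter_upwards [eventually_ge_atTop 1] with A hA
  have hA' : (0 : ℝ) < A := by exact_mod_cast hA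
  have hAk : (0 : ℝ) < (A : ℝ) + k := by positivity
  field_simp

/-! ## The bound at a fixed aspect ratio and the passage to the limit -/

/-- **Fixed aspect ratio.** From the finite-length bounds `γ₂(n) ≤ (−log P(m,n) + log C)/(m + k·n)`
(`m, n ≥ 1`) and Cardy-order convergence `−log P(A·n, n) → G` at an integer aspect ratio `A ≥ 1`,
every limit `L₂` of `n·γ₂(n)` satisfies `L₂ ≤ (G + log C)/(A + k)`: at `m = A·n` the bound times `n`
is exactly `(−log P(A·n,n) + log C)/(A + k)`. [folklore] -/
theorem qm2_limit_le_aspect {γ₂ : ℕ → ℝ} {P : ℕ → ℕ → ℝ} {C : ℝ} {k : ℕ}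
    (hfin : ∀ n : ℕ, 1 ≤ n → ∀ m : ℕ, 1 ≤ m →
      γ₂ n ≤ (-Real.log (P m n) + Real.log C) / ((m : ℝ) + k * n))
    {A : ℕ} (hA : 1 ≤ A) {G : ℝ} (hG : Tendsto (fun n : ℕ ↦ -Real.log (P (A * n) n)) atTop (𝓝 G))
    {L₂ : ℝ} (hL : Tendsto (fun n : ℕ ↦ (n : ℝ) * γ₂ n) atTop (𝓝 L₂)) :
    L₂ ≤ (G + Real.log C) / ((A : ℝ) + k) := by
  have hlim : Tendsto (fun n : ℕ ↦ (-Real.log (P (A * n) n) + Real.log C) / ((A : ℝ) + k)) atTop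
      (𝓝 ((G + Real.log C) / ((A : ℝ) + k))) :=
    (hG.add_const _).div_const _
  refine le_of_tendsto_of_tendsto hL hlim ?_
  filter_upwards [eventually_ge_atTop 1] with n hn
  have hn' : (0 : ℝ) < n := by exact_mod_cast hn
  have h := hfin n hn (A * n) (Nat.mul_pos hA hn)
  have hden : ((A * n : ℕ) : ℝ) + (k : ℝ) * (n : ℝ) = (n : ℝ) * ((A : ℝ) + k) := by
    push_cast; ring
  rw [hden] at h
  calc (n : ℝ) * γ₂ n
      ≤ (n : ℝ) * ((-Real.log (P (A * n) n) + Real.log C) / ((n : ℝ) * ((A : ℝ) + k))) :=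
        mul_le_mul_of_nonneg_left h hn'.le
    _ = (-Real.log (P (A * n) n) + Real.log C) / ((A : ℝ) + k) := by
        rw [← mul_div_assoc, mul_div_mul_left _ _ hn'.ne']

/-- **Registered form** (stub `qm_limit_le_of_finite_bounds` of stmt-CriticalPhenomena-13878, line
`two-cluster-rate-is-stationary-gap`, lead c5): the limsup half of the transfer "Cardy order ⇒
transfer-matrix order" MODULO quasi-multiplicativity. From the finite-length bounds
`γ₂(n) ≤ (−log P(m,n) + log C)/(m + k·n)` (`m, n ≥ 1`), Cardy-order convergence
`−log P(A·n, n) → g(A)` at every integer aspect ratio `A ≥ 1`, and `g(A)/A → c`, every limit `L₂` of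
`n·γ₂(n)` satisfies `L₂ ≤ c` (`L₂ ≤ (g A + log C)/(A + k) → c`). [folklore] -/
theorem qm_limit_le_of_finite_bounds : ∀ (γ₂ : ℕ → ℝ) (P : ℕ → ℕ → ℝ) (C : ℝ) (k : ℕ) (g : ℕ → ℝ) (c L₂ : ℝ), (∀ n : ℕ, 1 ≤ n → ∀ m : ℕ, 1 ≤ m → γ₂ n ≤ (-Real.log (P m n) + Real.log C) / ((m : ℝ) + k * n)) → (∀ A : ℕ, 1 ≤ A → Tendsto (fun n : ℕ ↦ -Real.log (P (A * n) n)) atTop (𝓝 (g A))) → Tendsto (fun A : ℕ ↦ g A / A) atTop (𝓝 c) → Tendsto (fun n : ℕ ↦ (n : ℝ) * γ₂ n) atTop (𝓝 L₂) → L₂ ≤ c := by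
  intro γ₂ P C k g c L₂ hfin hg hc hL
  refine ge_of_tendsto (qm2_tendsto_bound hc (Real.log C) k) ?_
  filter_upwards [eventually_ge_atTop 1] with A hA
  exact qm2_limit_le_aspect hfin hA (hg A hA) hL

end Summit.CriticalPhenomena.CardyFormulaZ2.Cruxes.StripClusterRates.TwoClusterRateIsStationaryGap

end
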